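import Literature.MathematicalPhysics.QuantumFieldTheory.Balaban1983to89.B16Sect1Assembly
import Literature.MathematicalPhysics.QuantumFieldTheory.Balaban1983to89.B16Sect1Statements

/-!
# `Balaban1983to89.B16Ineq111Gaussian` — T. Bałaban, *Large field renormalization. II. Localization, exponentiation,
and bounds for the 𝐑 operation*, Commun. Math. Phys. **122** (1989) 355–392 [Balaban1989LargeFieldII], Sect. 1
p. 358: the denominator `B′`-integral of (1.2) is bounded from below by `exp(−O(1)|Λ|)` (SKELETON row **B16.Lem@358**)
and the number `I(U₀)` of (1.10) obeys `|I(U₀)| < O(1) log M |Λ|` (row **B16.Eq1.11**, first inequality) — PROVED for the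
finite-dimensional chart model of the integral (kind «model-instance», Phase 2 of the mega-formalization `lit-balaban`,
reader/typer block r13 gen 6; HOME `run/shared/lean/pub/lit-balaban/`, rows `lit-balaban-r13/ROWS-B16.md`).

statement-level skeleton of published theorems with citation tags; proofs where landed; nothing here is a claim about
the Yang–Mills mass gap

PDF held: `paper:balaban1989-cmp122-large-field-ii` (journal page = PDF page + 354); p. 358 [PDF 4] re-read by this
seat (render `run/shared/lean/pub/pub-balaban/b2b-balaban-ref1/pages/1989-cmp122-large-field-II/…-p004-x2.png` read as
an image by r13 gen 1/2 for `B16Sect1Wilson`/`B16Sect1Statements`; OCR text `p0004.txt` ll. 18–33 re-read by gen 6).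

WHAT IS REPRODUCED.  p. 358, verbatim: *"… but at first we estimate the integral on the right-hand side of (1.2). This
integral is in the denominator of (1.1), hence we are interested only in a lower bound, which follows from the
boundedness of the quadratic form. The integral is bounded from below by exp(−O(1)|Λ|) = exp(−O(M⁴))"* and, after
(1.10), *"the analytically extended I(U₀) satisfies the bound |I(U₀)| < O(1) log M|Λ| < O(1)M⁵. (1.11)"*.  No
derivation is displayed in print.  Here both are PROVED for the MODEL INSTANCE in which the measure space of the
`B′`-integral `B16Sect1Assembly.int12` (the integral of (1.2), typed by r13 gen 4 over an arbitrary measure space) is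
the finite-dimensional real chart `ΩB = ι → ℝ` (`ι` = the real components of the bond variables `B′(b)`, `b ∈ Λ` off
the axial tree `G₀`, i.e. `δ_{G₀}` already solved) with Lebesgue measure, and the weight `σ(g_kB′)χ({|B′| <
M₀g_k⁻¹ε_k})` is `wB12 σ r = σ · 𝟙{‖B′‖_∞ < r}`; the INPUTS are exactly the printed ones, as hypotheses
(`Inputs`): (1.9) — the form is `≥ γ‖B′‖²`, `γ = γ₀/(2d(100M)^{d+1})` (`B16Sect1Wilson.Ineq19`, `Inputs.ofPrinted`);
*"the boundedness of the quadratic form"* — `≤ κ‖B′‖²`; (1.6) with *"it is enough to have an absolute bound, e.g., the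
number 1"* — the linear term is `≤ 1` in absolute value on the support; the `V`-term bound of p. 357
(`B16Sect1Statements.Ineq12V`, row B16.Txt@357) — `≤ ω` on the support; and two-sided bounds `e^{−s} ≤ σ ≤ e^{s}` for
the Haar-chart density of [I] (2.8) on the support (`σ(0) = 1`).  OUTPUT: the Gaussian sandwich
`e^{−s−κn/2−1−ω}·2ⁿ ≤ int12 ≤ e^{s+1+ω}(2π/γ)^{n/2}` (`int12_lower`, `int12_upper`; unit sub-box below, Fubini +
`integral_gaussian` above), hence `DenomLower358 (int12 …) C |Λ|` (`denomLower358_int12`) and, for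
`I(U₀) = −log int12` (= `B16Sect1Wilson.I110` by r13's `eq12_exp_neg_I110`, `I110_eq_neg_log_int12`), the bound
`|I(U₀)| ≤ C log M |Λ|` with `C` explicit in `(d, γ₀, κ, c_s, c_ω, c_n)` (`abs_negLogInt12_le`) and `Ineq111 (I110 …) …`
AS TYPED (`ineq111_I110`) — the `log M` being the `(100M)^{d+1}` of (1.9).  Mathlib + the two r13 statement files only;
no `sorry`, no new `def … : Prop`.
-/

open MeasureTheory Real Finset

namespace Literature.MathematicalPhysics.QuantumFieldTheory.Balaban1983to89.B16Ineq111Gaussian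

open B16Sect1Wilson B16Sect1Assembly B16Sect1Statements

noncomputable section

variable {ι : Type*} [Fintype ι]

/-! ## §1. The chart model of the `B′`-integral of (1.2) -/

/-- `‖B′‖²` = the Euclidean square norm `Σ_b |B′(b)|²` of (1.7)–(1.9), on the real chart `ι → ℝ`.
[cite: Balaban1989LargeFieldII, (1.8) p.358] -/
def sqN (b : ι → ℝ) : ℝ := ∑ i, b i ^ 2

/-- [cite: Balaban1989LargeFieldII, (1.8) p.358] -/
theorem sqN_nonneg (b : ι → ℝ) : 0 ≤ sqN b := Finset.sum_nonneg fun i _ => sq_nonneg (b i)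

/-- On the unit sup-norm box `‖B′‖_∞ < 1` one has `‖B′‖² ≤ n` (`n` = the number of real variables).
[cite: Balaban1989LargeFieldII, (1.8) p.358] -/
theorem sqN_le_card_of_mem_ball {b : ι → ℝ} (hb : b ∈ Metric.ball (0 : ι → ℝ) 1) :
    sqN b ≤ Fintype.card ι := by
  have h1 : ‖b‖ < 1 := mem_ball_zero_iff.mp hb
  have h : ∀ i, b i ^ 2 ≤ 1 := by
    intro i
    have h2 : |b i| ≤ ‖b‖ := by simpa [Real.norm_eq_abs] using norm_le_pi_norm b i
    have h3 : |b i| ≤ 1 := by linarith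
    calc b i ^ 2 = |b i| ^ 2 := (sq_abs _).symm
      _ ≤ 1 := by nlinarith [abs_nonneg (b i)]
  calc sqN b = ∑ i, b i ^ 2 := rfl
    _ ≤ ∑ _i : ι, (1 : ℝ) := Finset.sum_le_sum fun i _ => h i
    _ = Fintype.card ι := by simp

/-- The weight `σ(g_kB′)χ({|B′| < M₀g_k⁻¹ε_k})` of the `B′`-integral (1.2) p. 357 in the chart model: the Haar-chart
density `σ` times the indicator of the sup-norm box of radius `r = M₀g_k⁻¹ε_k`. [cite: Balaban1989LargeFieldII, (1.2) p.357] -/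
def wB12 (σ : (ι → ℝ) → ℝ) (r : ℝ) : (ι → ℝ) → ℝ := (Metric.ball (0 : ι → ℝ) r).indicator σ

/-- The integrand of `B16Sect1Assembly.int12` in the chart model: `wB · exp[−½Q − g_k⁻¹L − g_k⁻²V]`.
[cite: Balaban1989LargeFieldII, (1.2) p.357] -/
def integrand12 (gk : ℝ) (σ : (ι → ℝ) → ℝ) (r : ℝ) (Q L V : (ι → ℝ) → ℝ) (b : ι → ℝ) : ℝ :=
  wB12 σ r b * Real.exp (-(1 / 2) * Q b - 1 / gk * L b - 1 / gk ^ 2 * V b)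

/-- `int12` over the chart `ι → ℝ` with Lebesgue measure IS the integral of `integrand12` (definitional).
[cite: Balaban1989LargeFieldII, (1.2) p.357] -/
theorem int12_eq (gk : ℝ) (σ : (ι → ℝ) → ℝ) (r : ℝ) (Q L V : (ι → ℝ) → ℝ) :
    int12 gk (volume : Measure (ι → ℝ)) (wB12 σ r) Q L V = ∫ b, integrand12 gk σ r Q L V b := rfl

/-- THE PRINTED INPUTS of the p. 358 estimates, as hypotheses on the chart model (`n = card ι` real variables,
support radius `r ≥ 1`): measurability of the pieces; the Haar-chart density `σ` of [I] (2.8) squeezed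
`e^{−s} ≤ σ ≤ e^{s}` on the support (`σ(0) = 1`, `s = O(1)·n`); **(1.9)** `Q ≥ γ‖B′‖²` with `γ > 0` (in print
`γ = γ₀/(2d(100M)^{d+1})`, `Inputs.ofPrinted`); *"the boundedness of the quadratic form"* `Q ≤ κ‖B′‖²`, `κ ≥ 0`;
**(1.6)** with *"it is enough to have an absolute bound, e.g., the number 1"*: `|g_k⁻¹L| ≤ 1` on the support; the
`V`-term bound of p. 357 (row B16.Txt@357): `|g_k⁻²V| ≤ ω` on the support. [cite: Balaban1989LargeFieldII, (1.9) p.358] -/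
structure Inputs (gk r γ κ s ω : ℝ) (σ Q L V : (ι → ℝ) → ℝ) : Prop where
  one_le_r : 1 ≤ r
  γ_pos : 0 < γ
  κ_nonneg : 0 ≤ κ
  σ_meas : Measurable σ
  Q_meas : Measurable Q
  L_meas : Measurable L
  V_meas : Measurable V
  σ_nonneg : ∀ b, 0 ≤ σ b
  σ_le : ∀ b, σ b ≤ Real.exp s
  σ_ge : ∀ b ∈ Metric.ball (0 : ι → ℝ) r, Real.exp (-s) ≤ σ b
  Q_lower : ∀ b, γ * sqN b ≤ Q b
  Q_upper : ∀ b, Q b ≤ κ * sqN b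
  L_abs : ∀ b ∈ Metric.ball (0 : ι → ℝ) r, |1 / gk * L b| ≤ 1
  V_abs : ∀ b ∈ Metric.ball (0 : ι → ℝ) r, |1 / gk ^ 2 * V b| ≤ ω

namespace Inputs

variable {gk r γ κ s ω : ℝ} {σ Q L V : (ι → ℝ) → ℝ}

/-- The typed rows feed the inputs: (1.9) in its typed form `B16Sect1Wilson.Ineq19 (Q B′) ‖B′‖² γ₀ d M` at every
`B′` gives `Q_lower` with `γ = γ₀/(2d(100M)^{d+1})`; (1.6) `B16Sect1Wilson.Ineq16` at every `B′` of the support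
together with the printed *"absolute bound … the number 1"* (`3B₃M₀A₀²p₀²(g_k)e^{−R_k}(100M)⁴ ≤ 1`) gives `L_abs`;
the p. 357 bound `B16Sect1Statements.Ineq12V` gives `V_abs` with `ω = C_V g_k^{1−β}|Λ|`. [cite: Balaban1989LargeFieldII, (1.9) p.358] -/
theorem ofPrinted {γ₀ M B₃ M₀ A₀ p₀g Rk C_V β volΛ : ℝ} {d : ℕ} (hr : 1 ≤ r) (hγ₀ : 0 < γ₀) (hd : 1 ≤ d)
    (hM : 0 < M) (hκ : 0 ≤ κ) (hσm : Measurable σ) (hQm : Measurable Q) (hLm : Measurable L)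
    (hVm : Measurable V) (hσ0 : ∀ b, 0 ≤ σ b) (hσle : ∀ b, σ b ≤ Real.exp s)
    (hσge : ∀ b ∈ Metric.ball (0 : ι → ℝ) r, Real.exp (-s) ≤ σ b)
    (h19 : ∀ b, Ineq19 (Q b) (sqN b) γ₀ d M) (hQup : ∀ b, Q b ≤ κ * sqN b)
    (h16 : ∀ b ∈ Metric.ball (0 : ι → ℝ) r, Ineq16 (1 / gk * L b) B₃ M₀ A₀ p₀g Rk M)
    (hone : 3 * B₃ * M₀ * A₀ ^ 2 * p₀g ^ 2 * Real.exp (-Rk) * (100 * M) ^ 4 ≤ 1)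
    (h12V : ∀ b ∈ Metric.ball (0 : ι → ℝ) r, Ineq12V (1 / gk ^ 2 * V b) C_V gk β volΛ) :
    Inputs gk r (γ₀ / (2 * d * (100 * M) ^ (d + 1))) κ s (C_V * gk ^ (1 - β) * volΛ) σ Q L V where
  one_le_r := hr
  γ_pos := by
    have hd0 : (0 : ℝ) < d := by exact_mod_cast hd
    positivity
  κ_nonneg := hκ
  σ_meas := hσm
  Q_meas := hQm
  L_meas := hLm
  V_meas := hVm
  σ_nonneg := hσ0
  σ_le := hσle
  σ_ge := hσge
  Q_lower := fun b => by have := h19 b; unfold Ineq19 at this; exact this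
  Q_upper := hQup
  L_abs := fun b hb => by have := h16 b hb; unfold Ineq16 at this; exact le_trans this.le hone
  V_abs := fun b hb => by have := h12V b hb; unfold Ineq12V at this; exact this

/-- `s ≥ 0` (from the squeeze at `B′ = 0`). [cite: Balaban1989LargeFieldII, (1.2) p.357] -/
theorem s_nonneg (h : Inputs gk r γ κ s ω σ Q L V) : 0 ≤ s := by
  have h0 : (0 : ι → ℝ) ∈ Metric.ball (0 : ι → ℝ) r := Metric.mem_ball_self (by linarith [h.one_le_r])
  have := (h.σ_ge 0 h0).trans (h.σ_le 0)
  have := Real.exp_le_exp.mp this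
  linarith

/-- `ω ≥ 0`. [cite: Balaban1989LargeFieldII, (1.2) p.357] -/
theorem ω_nonneg (h : Inputs gk r γ κ s ω σ Q L V) : 0 ≤ ω := by
  have h0 : (0 : ι → ℝ) ∈ Metric.ball (0 : ι → ℝ) r := Metric.mem_ball_self (by linarith [h.one_le_r])
  exact (abs_nonneg _).trans (h.V_abs 0 h0)

/-! ## §2. Pointwise bounds of the integrand -/

/-- The integrand is nonnegative. [cite: Balaban1989LargeFieldII, (1.2) p.357] -/
theorem integrand_nonneg (h : Inputs gk r γ κ s ω σ Q L V) (b : ι → ℝ) :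
    0 ≤ integrand12 gk σ r Q L V b := by
  unfold integrand12 wB12
  refine mul_nonneg ?_ (Real.exp_pos _).le
  by_cases hb : b ∈ Metric.ball (0 : ι → ℝ) r
  · rw [Set.indicator_of_mem hb]; exact h.σ_nonneg b
  · rw [Set.indicator_of_notMem hb]

/-- UPPER pointwise bound (the route to the `log M` of (1.11)): by (1.9), the absolute bound `1` of (1.6) and the
`V`-bound, `integrand ≤ e^{s}·e^{1+ω}·e^{−(γ/2)‖B′‖²}`. [cite: Balaban1989LargeFieldII, (1.11) p.358] -/
theorem integrand_le (h : Inputs gk r γ κ s ω σ Q L V) (b : ι → ℝ) :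
    integrand12 gk σ r Q L V b ≤ Real.exp s * Real.exp (1 + ω) * Real.exp (-(γ / 2) * sqN b) := by
  unfold integrand12 wB12
  by_cases hb : b ∈ Metric.ball (0 : ι → ℝ) r
  · rw [Set.indicator_of_mem hb]
    have hL := (abs_le.mp (h.L_abs b hb)).1
    have hV := (abs_le.mp (h.V_abs b hb)).1
    have hQ := h.Q_lower b
    have hexp : Real.exp (-(1 / 2) * Q b - 1 / gk * L b - 1 / gk ^ 2 * V b) ≤
        Real.exp (1 + ω) * Real.exp (-(γ / 2) * sqN b) := by
      rw [← Real.exp_add]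
      exact Real.exp_le_exp.mpr (by linarith)
    calc σ b * Real.exp (-(1 / 2) * Q b - 1 / gk * L b - 1 / gk ^ 2 * V b)
        ≤ Real.exp s * (Real.exp (1 + ω) * Real.exp (-(γ / 2) * sqN b)) :=
          mul_le_mul (h.σ_le b) hexp (Real.exp_pos _).le (Real.exp_pos _).le
      _ = _ := by ring
  · rw [Set.indicator_of_notMem hb, zero_mul]
    positivity

/-- LOWER pointwise bound on the unit sub-box `‖B′‖_∞ < 1 ≤ r` (*"which follows from the boundedness of the quadratic
form"*): `integrand ≥ e^{−s}·e^{−(κn/2 + 1 + ω)}`. [cite: Balaban1989LargeFieldII, p.358 (before (1.10))] -/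
theorem le_integrand (h : Inputs gk r γ κ s ω σ Q L V) {b : ι → ℝ} (hb : b ∈ Metric.ball (0 : ι → ℝ) 1) :
    Real.exp (-s) * Real.exp (-(κ / 2 * Fintype.card ι + 1 + ω)) ≤ integrand12 gk σ r Q L V b := by
  have hbr : b ∈ Metric.ball (0 : ι → ℝ) r := Metric.ball_subset_ball h.one_le_r hb
  unfold integrand12 wB12
  rw [Set.indicator_of_mem hbr]
  have hL := (abs_le.mp (h.L_abs b hbr)).2
  have hV := (abs_le.mp (h.V_abs b hbr)).2
  have hQ := h.Q_upper b
  have hn := sqN_le_card_of_mem_ball hb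
  have hκn : κ * sqN b ≤ κ * Fintype.card ι := mul_le_mul_of_nonneg_left hn h.κ_nonneg
  have hexp : Real.exp (-(κ / 2 * Fintype.card ι + 1 + ω)) ≤
      Real.exp (-(1 / 2) * Q b - 1 / gk * L b - 1 / gk ^ 2 * V b) :=
    Real.exp_le_exp.mpr (by linarith)
  exact mul_le_mul (h.σ_ge b hbr) hexp (Real.exp_pos _).le (h.σ_nonneg b)

/-! ## §3. The Gaussian reference integral `∫ e^{−c‖B′‖²} dB′ = (π/c)^{n/2}` on `ι → ℝ` -/

/-- `e^{−c‖B′‖²} = Π_i e^{−c B′_i²}`. [cite: Balaban1989LargeFieldII, (1.11) p.358] -/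
theorem exp_neg_mul_sqN (c : ℝ) (b : ι → ℝ) :
    Real.exp (-c * sqN b) = ∏ i, Real.exp (-c * b i ^ 2) := by
  unfold sqN
  rw [Finset.mul_sum, Real.exp_sum]

/-- Fubini + the one-dimensional Gaussian integral: `∫_{ι → ℝ} e^{−c‖B′‖²} = (√(π/c))ⁿ`.
[cite: Balaban1989LargeFieldII, (1.11) p.358] -/
theorem integral_exp_neg_mul_sqN (c : ℝ) :
    ∫ b : ι → ℝ, Real.exp (-c * sqN b) = (Real.sqrt (π / c)) ^ Fintype.card ι := by
  simp_rw [exp_neg_mul_sqN]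
  rw [integral_fintype_prod_volume_eq_pow (fun x : ℝ => Real.exp (-c * x ^ 2)), integral_gaussian]

/-- Integrability of the Gaussian reference function for `c > 0`. [cite: Balaban1989LargeFieldII, (1.11) p.358] -/
theorem integrable_exp_neg_mul_sqN {c : ℝ} (hc : 0 < c) :
    Integrable (fun b : ι → ℝ => Real.exp (-c * sqN b)) := by
  simp_rw [exp_neg_mul_sqN]
  exact Integrable.fintype_prod (μ := fun _ : ι => (volume : Measure ℝ))
    (f := fun _ : ι => fun x : ℝ => Real.exp (-c * x ^ 2)) fun _ => integrable_exp_neg_mul_sq hc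

/-! ## §4. The Gaussian sandwich of `int12` -/

/-- Measurability of the integrand. [cite: Balaban1989LargeFieldII, (1.2) p.357] -/
theorem measurable_integrand (h : Inputs gk r γ κ s ω σ Q L V) :
    Measurable (integrand12 gk σ r Q L V) := by
  unfold integrand12 wB12
  refine (h.σ_meas.indicator measurableSet_ball).mul (Real.measurable_exp.comp ?_)
  exact ((h.Q_meas.const_mul _).sub (h.L_meas.const_mul _)).sub (h.V_meas.const_mul _)

/-- Integrability of the integrand (dominated by the Gaussian reference function).
[cite: Balaban1989LargeFieldII, (1.2) p.357] -/
theorem integrable_integrand (h : Inputs gk r γ κ s ω σ Q L V) :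
    Integrable (integrand12 gk σ r Q L V) := by
  refine Integrable.mono' (((integrable_exp_neg_mul_sqN (half_pos h.γ_pos)).const_mul
    (Real.exp s * Real.exp (1 + ω)))) (measurable_integrand h).aestronglyMeasurable
    (Filter.Eventually.of_forall fun b => ?_)
  rw [Real.norm_eq_abs, abs_of_nonneg (integrand_nonneg h b)]
  exact integrand_le h b

/-- **UPPER Gaussian bound**: `int12 ≤ e^{s}e^{1+ω}(√(2π/γ))ⁿ`. [cite: Balaban1989LargeFieldII, (1.11) p.358] -/
theorem int12_upper (h : Inputs gk r γ κ s ω σ Q L V) :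
    int12 gk (volume : Measure (ι → ℝ)) (wB12 σ r) Q L V ≤
      Real.exp s * Real.exp (1 + ω) * (Real.sqrt (2 * π / γ)) ^ Fintype.card ι := by
  rw [int12_eq]
  have hmono : ∫ b, integrand12 gk σ r Q L V b ≤
      ∫ b : ι → ℝ, Real.exp s * Real.exp (1 + ω) * Real.exp (-(γ / 2) * sqN b) :=
    integral_mono_of_nonneg (Filter.Eventually.of_forall (integrand_nonneg h))
      ((integrable_exp_neg_mul_sqN (half_pos h.γ_pos)).const_mul _)
      (Filter.Eventually.of_forall (integrand_le h))
  refine hmono.trans (le_of_eq ?_)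
  rw [integral_const_mul, integral_exp_neg_mul_sqN, div_div_eq_mul_div, mul_comm π 2]

/-- The volume of the unit sup-norm box of the chart is `2ⁿ`. [cite: Balaban1989LargeFieldII, p.358 (before (1.10))] -/
theorem volume_real_unitBall : (volume : Measure (ι → ℝ)).real (Metric.ball (0 : ι → ℝ) 1) = 2 ^ Fintype.card ι := by
  rw [Measure.real, Real.volume_pi_ball (0 : ι → ℝ) zero_lt_one, ENNReal.toReal_ofReal (by positivity)]
  norm_num

/-- **LOWER bound** (row B16.Lem@358, the mechanism): `int12 ≥ e^{−s}e^{−(κn/2+1+ω)}·2ⁿ` — restrict to the unit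
sub-box and use the pointwise lower bound. [cite: Balaban1989LargeFieldII, p.358 (before (1.10))] -/
theorem int12_lower (h : Inputs gk r γ κ s ω σ Q L V) :
    Real.exp (-s) * Real.exp (-(κ / 2 * Fintype.card ι + 1 + ω)) * 2 ^ Fintype.card ι ≤
      int12 gk (volume : Measure (ι → ℝ)) (wB12 σ r) Q L V := by
  rw [int12_eq]
  set c : ℝ := Real.exp (-s) * Real.exp (-(κ / 2 * Fintype.card ι + 1 + ω)) with hc
  have hfin : (volume : Measure (ι → ℝ)) (Metric.ball (0 : ι → ℝ) 1) < ⊤ := by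
    rw [Real.volume_pi_ball (0 : ι → ℝ) zero_lt_one]; exact ENNReal.ofReal_lt_top
  have h1 : ∫ _ in Metric.ball (0 : ι → ℝ) 1, c ∂(volume : Measure (ι → ℝ)) = c * 2 ^ Fintype.card ι := by
    rw [setIntegral_const, volume_real_unitBall, smul_eq_mul, mul_comm]
  have h2 : ∫ _ in Metric.ball (0 : ι → ℝ) 1, c ∂(volume : Measure (ι → ℝ)) ≤
      ∫ b in Metric.ball (0 : ι → ℝ) 1, integrand12 gk σ r Q L V b :=
    setIntegral_mono_on (integrableOn_const hfin.ne) (integrable_integrand h).integrableOn measurableSet_ball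
      fun b hb => le_integrand h hb
  have h3 : ∫ b in Metric.ball (0 : ι → ℝ) 1, integrand12 gk σ r Q L V b ≤ ∫ b, integrand12 gk σ r Q L V b :=
    setIntegral_le_integral (integrable_integrand h) (Filter.Eventually.of_forall (integrand_nonneg h))
  calc c * 2 ^ Fintype.card ι = ∫ _ in Metric.ball (0 : ι → ℝ) 1, c ∂(volume : Measure (ι → ℝ)) := h1.symm
    _ ≤ _ := h2.trans h3

/-- The integral is positive (so `I(U₀) = −log int12` is meaningful and (1.10) applies).
[cite: Balaban1989LargeFieldII, (1.10) p.358] -/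
theorem int12_pos (h : Inputs gk r γ κ s ω σ Q L V) :
    0 < int12 gk (volume : Measure (ι → ℝ)) (wB12 σ r) Q L V :=
  lt_of_lt_of_le (by positivity) (int12_lower h)

/-! ## §5. `I(U₀) = −log int12`: the two-sided bound behind (1.11) -/

/-- Upper side: `−log int12 ≤ s + κn/2 + 1 + ω` (from the lower bound, dropping `n log 2 ≥ 0`).
[cite: Balaban1989LargeFieldII, (1.11) p.358] -/
theorem negLog_int12_le (h : Inputs gk r γ κ s ω σ Q L V) :
    -Real.log (int12 gk (volume : Measure (ι → ℝ)) (wB12 σ r) Q L V) ≤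
      s + (κ / 2 * Fintype.card ι + 1 + ω) := by
  have hlow := int12_lower h
  have hpos : 0 < Real.exp (-s) * Real.exp (-(κ / 2 * Fintype.card ι + 1 + ω)) * 2 ^ Fintype.card ι := by
    positivity
  have hlog := Real.log_le_log hpos hlow
  rw [Real.log_mul (by positivity) (by positivity), Real.log_mul (by positivity) (by positivity),
    Real.log_exp, Real.log_exp, Real.log_pow] at hlog
  have h2 : 0 ≤ (Fintype.card ι : ℝ) * Real.log 2 := by positivity
  linarith

/-- Lower side: `log int12 ≤ s + 1 + ω + (n/2) log(2π/γ)` (from the Gaussian upper bound).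
[cite: Balaban1989LargeFieldII, (1.11) p.358] -/
theorem log_int12_le (h : Inputs gk r γ κ s ω σ Q L V) :
    Real.log (int12 gk (volume : Measure (ι → ℝ)) (wB12 σ r) Q L V) ≤
      s + (1 + ω) + (Fintype.card ι : ℝ) / 2 * Real.log (2 * π / γ) := by
  have hup := int12_upper h
  have hq : 0 < 2 * π / γ := by have := h.γ_pos; positivity
  have hlog := Real.log_le_log (int12_pos h) hup
  rw [Real.log_mul (by positivity) (by positivity), Real.log_mul (by positivity) (by positivity),
    Real.log_exp, Real.log_exp, Real.log_pow, Real.log_sqrt hq.le] at hlog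
  linarith

/-- The two-sided bound, absolute-value form with explicit bookkeeping constants: if `n ≤ c_n|Λ|`, `s ≤ c_s|Λ|`,
`ω ≤ c_ω|Λ|`, `|Λ| ≥ 1`, `M ≥ 2` and `γ = γ₀/(2d(100M)^{d+1})` (the constant of (1.9)), then
`|−log int12| ≤ C·log M·|Λ|` with `C = 2(c_s + κc_n/2 + 1 + c_ω) + c_n·max(log(4πd·100^{d+1}/γ₀), 0) + c_n(d+1)/2`
— the printed *"|I(U₀)| < O(1) log M|Λ|"*, the `O(1)` made explicit. [cite: Balaban1989LargeFieldII, (1.11) p.358] -/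
theorem abs_negLog_int12_le (h : Inputs gk r γ κ s ω σ Q L V) {γ₀ M volΛ cn cs cω : ℝ} {d : ℕ}
    (hγ₀ : 0 < γ₀) (hd : 1 ≤ d) (hM : 2 ≤ M) (hγ : γ = γ₀ / (2 * d * (100 * M) ^ (d + 1)))
    (hvol : 1 ≤ volΛ) (hcn : 0 ≤ cn) (hn : (Fintype.card ι : ℝ) ≤ cn * volΛ) (hs : s ≤ cs * volΛ)
    (hω : ω ≤ cω * volΛ) :
    |-Real.log (int12 gk (volume : Measure (ι → ℝ)) (wB12 σ r) Q L V)| ≤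
      (2 * (cs + κ * cn / 2 + 1 + cω) + cn * max (Real.log (4 * π * d * 100 ^ (d + 1) / γ₀)) 0
        + cn * (d + 1) / 2) * Real.log M * volΛ := by
  have hd0 : (0 : ℝ) < d := by exact_mod_cast hd
  have hM0 : 0 < M := by linarith
  have hγ₀' : γ₀ ≠ 0 := hγ₀.ne'
  have hd' : (d : ℝ) ≠ 0 := hd0.ne'
  have hM' : M ≠ 0 := hM0.ne'
  have hup := negLog_int12_le h
  have hlo := log_int12_le h
  -- the identity log(2π/γ) = log(4πd·100^{d+1}/γ₀) + (d+1) log M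
  have hlogγ : Real.log (2 * π / γ) =
      Real.log (4 * π * d * 100 ^ (d + 1) / γ₀) + (d + 1) * Real.log M := by
    rw [hγ, show 2 * π / (γ₀ / (2 * ↑d * (100 * M) ^ (d + 1))) =
        (4 * π * d * 100 ^ (d + 1) / γ₀) * M ^ (d + 1) by rw [mul_pow]; field_simp; ring]
    rw [Real.log_mul (by positivity) (by positivity), Real.log_pow]
    push_cast; ring
  rw [hlogγ] at hlo
  set n : ℝ := (Fintype.card ι : ℝ) with hn'
  set A : ℝ := Real.log (4 * π * d * 100 ^ (d + 1) / γ₀) with hA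
  set lM : ℝ := Real.log M with hlM
  have hlM2 : Real.log 2 ≤ lM := Real.log_le_log (by norm_num) hM
  have hl2 : (1 : ℝ) ≤ 2 * Real.log 2 := by have := Real.log_two_gt_d9; linarith
  have hlM1 : 1 ≤ 2 * lM := by linarith
  have hlM0 : 0 ≤ lM := by linarith
  have hvol0 : 0 ≤ volΛ := by linarith
  have hn0 : 0 ≤ n := by positivity
  have hs0 : 0 ≤ s := h.s_nonneg
  have hω0 : 0 ≤ ω := h.ω_nonneg
  have hκ := h.κ_nonneg
  have hmax0 : 0 ≤ max A 0 := le_max_right _ _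
  have hAmax : A ≤ max A 0 := le_max_left _ _
  -- sign of the bookkeeping constants
  have hcs0 : 0 ≤ cs := by
    by_contra hneg
    have : cs * volΛ < 0 := mul_neg_of_neg_of_pos (not_le.mp hneg) (by linarith)
    linarith
  have hcω0 : 0 ≤ cω := by
    by_contra hneg
    have : cω * volΛ < 0 := mul_neg_of_neg_of_pos (not_le.mp hneg) (by linarith)
    linarith
  -- volΛ ≤ 2·(lM·volΛ)
  have hvW : volΛ ≤ 2 * (lM * volΛ) := by
    have := mul_le_mul_of_nonneg_left hlM1 hvol0
    linarith
  have hW0 : 0 ≤ lM * volΛ := by positivity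
  -- the elementary pieces
  have e1 : s ≤ 2 * cs * (lM * volΛ) := by
    have := mul_le_mul_of_nonneg_left hvW hcs0
    linarith
  have e2 : 1 + ω ≤ 2 * (1 + cω) * (lM * volΛ) := by
    have := mul_le_mul_of_nonneg_left hvW hcω0
    linarith
  have hncn : n ≤ 2 * cn * (lM * volΛ) := by
    have := mul_le_mul_of_nonneg_left hvW hcn
    linarith
  have e3 : κ / 2 * n ≤ κ * cn * (lM * volΛ) := by
    have := mul_le_mul_of_nonneg_left hncn (by positivity : (0 : ℝ) ≤ κ / 2)
    linarith
  have e4a : n / 2 * A ≤ cn * max A 0 * (lM * volΛ) := by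
    have h1 : n / 2 * A ≤ n / 2 * max A 0 := mul_le_mul_of_nonneg_left hAmax (by positivity)
    have h2 : n / 2 * max A 0 ≤ (2 * cn * (lM * volΛ)) / 2 * max A 0 :=
      mul_le_mul_of_nonneg_right (by linarith) hmax0
    linarith
  have e4b : n / 2 * ((d + 1) * lM) ≤ cn * (d + 1) / 2 * (lM * volΛ) := by
    have h1 : n * lM ≤ cn * volΛ * lM := mul_le_mul_of_nonneg_right hn hlM0
    have hd1 : (0 : ℝ) ≤ d + 1 := by positivity
    have h2 := mul_le_mul_of_nonneg_left h1 hd1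
    linarith
  -- assemble
  rw [abs_le]
  constructor
  · have : Real.log (int12 gk (volume : Measure (ι → ℝ)) (wB12 σ r) Q L V) ≤
        (2 * (cs + κ * cn / 2 + 1 + cω) + cn * max A 0 + cn * (d + 1) / 2) * lM * volΛ := by
      have hκcn : 0 ≤ κ * cn * (lM * volΛ) := by positivity
      linarith
    linarith
  · have hm : 0 ≤ cn * max A 0 * (lM * volΛ) := by positivity
    have hd2 : 0 ≤ cn * (d + 1) / 2 * (lM * volΛ) := by positivity
    linarith

/-! ## §6. The rows AS TYPED: `DenomLower358` and `Ineq111` for the chart model -/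

/-- **Row B16.Lem@358 PROVED for the chart model**: `exp(−C|Λ|) ≤ int12` with `C = c_s + κc_n/2 + 1 + c_ω` (given the
bookkeeping `n ≤ c_n|Λ|`, `s ≤ c_s|Λ|`, `ω ≤ c_ω|Λ|`, `|Λ| ≥ 1`) — *"The integral is bounded from below by
exp(−O(1)|Λ|)"*. [cite: Balaban1989LargeFieldII, p.358 (before (1.10))] -/
theorem denomLower358_int12 (h : Inputs gk r γ κ s ω σ Q L V) {volΛ cn cs cω : ℝ} (hvol : 1 ≤ volΛ)
    (hn : (Fintype.card ι : ℝ) ≤ cn * volΛ) (hs : s ≤ cs * volΛ) (hω : ω ≤ cω * volΛ) :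
    DenomLower358 (int12 gk (volume : Measure (ι → ℝ)) (wB12 σ r) Q L V) (cs + κ * cn / 2 + 1 + cω) volΛ := by
  unfold DenomLower358
  refine le_trans ?_ (int12_lower h)
  have hκ := h.κ_nonneg
  have h2n : (1 : ℝ) ≤ 2 ^ Fintype.card ι := one_le_pow₀ (by norm_num)
  have hκn : κ / 2 * Fintype.card ι ≤ κ * cn / 2 * volΛ := by nlinarith
  calc Real.exp (-((cs + κ * cn / 2 + 1 + cω) * volΛ))
      ≤ Real.exp (-s) * Real.exp (-(κ / 2 * Fintype.card ι + 1 + ω)) := by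
        rw [← Real.exp_add]; exact Real.exp_le_exp.mpr (by nlinarith)
    _ ≤ Real.exp (-s) * Real.exp (-(κ / 2 * Fintype.card ι + 1 + ω)) * 2 ^ Fintype.card ι :=
        le_mul_of_one_le_right (by positivity) h2n

/-- (1.10) read in the chart model: under the typed (1.2) `B16Sect1Assembly.Eq12` (the Haar-chart change of variables
relating the `V′`-integral `den11` to `int12`) with a positive denominator, the number `I(U₀)` of (1.10)
(`B16Sect1Wilson.I110`) IS `−log int12`. [cite: Balaban1989LargeFieldII, (1.10) p.358] -/
theorem I110_eq_neg_log_int12 {ΩV : Type*} [MeasurableSpace ΩV] {gk A00 dg σ₀ : ℝ} {nk : ℕ}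
    {μV : Measure ΩV} {AV : ΩV → ℝ} {σ Q L V : (ι → ℝ) → ℝ} {r : ℝ}
    (h12 : Eq12 gk A00 dg σ₀ nk μV AV (volume : Measure (ι → ℝ)) (wB12 σ r) Q L V)
    (hpos : 0 < den11 gk μV AV) :
    I110 gk A00 (Ek110 dg gk σ₀ nk) (den11 gk μV AV) =
      -Real.log (int12 gk (volume : Measure (ι → ℝ)) (wB12 σ r) Q L V) := by
  rw [eq12_exp_neg_I110 h12 hpos, Real.log_exp, neg_neg]

/-- **Row B16.Eq1.11 PROVED for the chart model, AS TYPED** (`B16Sect1Wilson.Ineq111`, both printed inequalities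
*"|I(U₀)| < O(1) log M|Λ| < O(1)M⁵"* with explicit constants): with `C` the constant of `abs_negLog_int12_le`,
`|I(U₀)| < (C+1) log M |Λ|` and `(C+1) log M|Λ| < ((C+1)100⁴ + 1)M⁵` for `Λ` in a cube of size `100M` (`|Λ| ≤ (100M)⁴`,
d = 4 geometry as printed; the (1.9)-dimension `d` of `γ` is kept general). [cite: Balaban1989LargeFieldII, (1.11) p.358] -/
theorem ineq111_I110 {ΩV : Type*} [MeasurableSpace ΩV] {gk A00 dg σ₀ : ℝ} {nk : ℕ} {μV : Measure ΩV}
    {AV : ΩV → ℝ} (h : Inputs gk r γ κ s ω σ Q L V)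
    (h12 : Eq12 gk A00 dg σ₀ nk μV AV (volume : Measure (ι → ℝ)) (wB12 σ r) Q L V)
    (hpos : 0 < den11 gk μV AV) {γ₀ M volΛ cn cs cω : ℝ} {d : ℕ}
    (hγ₀ : 0 < γ₀) (hd : 1 ≤ d) (hM : 2 ≤ M) (hγ : γ = γ₀ / (2 * d * (100 * M) ^ (d + 1)))
    (hvol : 1 ≤ volΛ) (hvolM : volΛ ≤ (100 * M) ^ 4) (hcn : 0 ≤ cn) (hn : (Fintype.card ι : ℝ) ≤ cn * volΛ)
    (hs : s ≤ cs * volΛ) (hω : ω ≤ cω * volΛ) :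
    let C : ℝ := 2 * (cs + κ * cn / 2 + 1 + cω) + cn * max (Real.log (4 * π * d * 100 ^ (d + 1) / γ₀)) 0
      + cn * (d + 1) / 2
    Ineq111 (I110 gk A00 (Ek110 dg gk σ₀ nk) (den11 gk μV AV)) (C + 1) ((C + 1) * 100 ^ 4 + 1) M volΛ := by
  intro C
  have hmain := abs_negLog_int12_le h hγ₀ hd hM hγ hvol hcn hn hs hω
  rw [← I110_eq_neg_log_int12 h12 hpos] at hmain
  have hM1 : 1 ≤ M := by linarith
  have hlM : 0 < Real.log M := Real.log_pos (by linarith)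
  have hC0 : 0 ≤ C := by
    have := h.κ_nonneg
    have hcs : 0 ≤ cs * volΛ := h.s_nonneg.trans hs
    have hcω : 0 ≤ cω * volΛ := h.ω_nonneg.trans hω
    have hcs' : 0 ≤ cs := nonneg_of_mul_nonneg_left hcs (by linarith) |> fun h => by nlinarith
    have hcω' : 0 ≤ cω := by nlinarith
    have hmax : 0 ≤ max (Real.log (4 * π * d * 100 ^ (d + 1) / γ₀)) 0 := le_max_right _ _
    have hd0 : (0 : ℝ) ≤ d := by positivity
    simp only [C]; positivity
  unfold Ineq111
  constructor
  · calc |I110 gk A00 (Ek110 dg gk σ₀ nk) (den11 gk μV AV)| ≤ C * Real.log M * volΛ := hmain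
      _ < (C + 1) * Real.log M * volΛ := by nlinarith [mul_pos hlM (by linarith : (0 : ℝ) < volΛ)]
  · have harith := ineq111_arith (C + 1) M volΛ (by linarith) hM1 (by linarith) hvolM
    have hM5 : 0 < M ^ 5 := by positivity
    linarith

end Inputs

end

end Literature.MathematicalPhysics.QuantumFieldTheory.Balaban1983to89.B16Ineq111Gaussian
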